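import Literature.Analysis.Calculus.WeightedTameComposition
import Literature.NumberTheory.Automorphic.ResGLnHermitianConeGauge
import Summits.Langlands.Langlands.Theorems.IrreducibilityBySelfDualityHeckeEigenvalueFieldStubReducedCover
import Summits.Langlands.Langlands.Theorems.IrreducibilityBySelfDualityHeckeEigenvalueFieldStubSiegelCutoff
import Summits.Langlands.Langlands.Theorems.IrreducibilityBySelfDualityHeckeEigenvalueFieldStubPOUNormalise
import Summits.Langlands.Langlands.Theorems.IrreducibilityBySelfDualityHeckeEigenvalueFieldStubHullRelOpen
import Summits.Langlands.Langlands.Theorems.IrreducibilityBySelfDualityHeckeEigenvalueFieldStubAssemblyLemmas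
import Literature.NumberTheory.Automorphic.ResGLnHermitianConeOpen
import Literature.NumberTheory.Automorphic.TwistedQuotientConeDescentRows
import Literature.NumberTheory.Automorphic.SiegelReducedFamilies
import HarnessLib

/-!
# A partition of unity for the arithmetic stabiliser of a coset, with growth data — crux
# HeckeEigenvalueField (stmt-Langlands-13632), line Sketch, stub `stub_fam_pou` (FAM-POU)

Namespace `Summit.Langlands.Langlands.Theorems.HeckeEigenvalueField.Res`; theorems only.

For a coset `c ∈ GL_n(𝔸_K^∞) ⧸ K_f(𝔫)` the arithmetic group `Γ_c = Stab(c).comap diagPos ≤ GL_n(K)⁺`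
acts on the cone `X = posCone n K` of positive hermitian matrices over `K_∞` by the continuous
linear maps `a_c γ : H ↦ γ H γᴴ` (`ResGLnCone.coneActionRat`).  We build a `Γ_c`-partition of unity
`ψ` on `X` (`TwistedQuotient.IsPOU`) together with its growth data:

* reduction constants `p₀ = (c₀, C₀, τ₀)` and a finite set `T ⊆ GL_n(K)` with
  `X = ⋃_{γ ∈ Γ_c, t ∈ T} (γ t) · R(p₀)` (COVER-FIN (i), `stub_reducedCone_cover_finite`);
* the smooth cut-off `χ` of POU-A (`stub_siegelCutoff`) between `p₀` and `p₁ = p₀ + 1`, its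
  `T`-symmetrisation `χ_T = ∑_{t ∈ T} χ ∘ t⁻¹`, clamped by the smooth transition `θ`
  (`Real.smoothTransition`, `= 1` on `[1, ∞)`): `χ₁ = θ ∘ χ_T` is smooth on `X`, lies in `[0, 1]`,
  equals `1` wherever some `χ ∘ t⁻¹ = 1` and vanishes unless some `χ ∘ t⁻¹ ≠ 0`;
* `ψ = χ₁ / ∑ᶠ_γ χ₁ ∘ a_c γ⁻¹` (POU-B, `stub_isPOU_of_cover`): the local finiteness of the translates
  and the vanishing of all but finitely many of them near the fundamental set
  `F' = ⋃_{t ∈ T} t · R(p₀)` come from COVER-FIN (ii) (for `p₁`), through the finite set `Δ ⊆ Γ_c`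
  of elements moving some `t · R(p₁)` onto some `t' · R(p₁)` (`t, t' ∈ T`) and the openness of the
  sets `{y ∈ X | (γ t)⁻¹ · y ∈ R(p₁)}` (`stub_hull_relOpen`);
* the `C²` bounds of the translates `ψ ∘ a_c γ⁻¹`, `γ ∈ Δ`, on `F'`, polynomial in the entry gauge
  `E(H) = 1 + ∑ (‖H i j‖ + ‖H⁻¹ i j‖)`: `χ` is tame for `E` (POU-A), hence so is
  `θ ∘ ∑_t χ ∘ (t⁻¹γ⁻¹ ·)` (`ResGLnCone.tame_smoothTransition_sum_translate`: chain rule through the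
  fixed linear maps, `E((γt)⁻¹ · H) ≤ C E(H)`, Faà di Bruno for `θ`), and the quotient rule of POU-B is
  assembled by `Literature.Analysis.Calculus.pou_translate_bounds`.

## References

* A. Borel, *Regularization theorems in Lie algebra cohomology. Applications*, Duke Math. J. 50
  (1983), §3.5. [Borel1983Regularization]
* A. Borel, *Introduction aux groupes arithmétiques*, Hermann (1969), §12–§15. [Borel1969]
* R. Bott, L. W. Tu, *Differential Forms in Algebraic Topology*, GTM 82 (1982), §II.8.
  [BottTu1982Forms]
-/

set_option linter.dupNamespace false -- project-wide: `Summit.Langlands.Langlands` is the mandated namespace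

noncomputable section

open scoped Classical Pointwise ComplexOrder Matrix ContDiff Topology
open Filter Set NumberField NumberField.mixedEmbedding IsDedekindDomain
open Literature.NumberTheory.Automorphic

namespace Summit.Langlands.Langlands.Theorems.HeckeEigenvalueField.Res

namespace FamPOU

variable {n : ℕ} {K : Type} [Field K] [NumberField K]

/-- **Translates of reduced sets are open in the cone**: for a fixed rational `A`, the set of
`y ∈ posCone` with `A · y` `(c, C, τ)`-reduced is open (reducedness is relatively open in the
hermitian families, `stub_hull_relOpen`; the family of places of a point of the cone is hermitian;
`y ↦ placeFamily (A · y)` is continuous). [cite: Borel1969, §12–§13] -/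
theorem isOpen_setOf_isReduced_coneActionRat (A : GL (Fin n) K) (c C τ : ℝ) :
    IsOpen {y : ResGLnCone.hermSpace n K | y ∈ ResGLnCone.posCone n K ∧
      SiegelFamily.IsReduced c C τ n (SiegelFamily.placeFamily K
        ((ResGLnCone.coneActionRat n K A y : ResGLnCone.hermSpace n K) :
          Matrix (Fin n) (Fin n) (mixedSpace K)))} := by
  obtain ⟨O, hO, hEq⟩ := stub_hull_relOpen (InfinitePlace K) n c C τ
  have hcont : Continuous fun y : ResGLnCone.hermSpace n K => SiegelFamily.placeFamily K
      ((ResGLnCone.coneActionRat n K A y : ResGLnCone.hermSpace n K) :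
        Matrix (Fin n) (Fin n) (mixedSpace K)) :=
    (SiegelFamily.continuous_placeFamily n).comp
      (continuous_subtype_val.comp (ResGLnCone.coneActionRat n K A).continuous)
  have h : {y : ResGLnCone.hermSpace n K | y ∈ ResGLnCone.posCone n K ∧
      SiegelFamily.IsReduced c C τ n (SiegelFamily.placeFamily K
        ((ResGLnCone.coneActionRat n K A y : ResGLnCone.hermSpace n K) :
          Matrix (Fin n) (Fin n) (mixedSpace K)))} =
      ResGLnCone.posCone n K ∩ (fun y : ResGLnCone.hermSpace n K => SiegelFamily.placeFamily K
        ((ResGLnCone.coneActionRat n K A y : ResGLnCone.hermSpace n K) :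
          Matrix (Fin n) (Fin n) (mixedSpace K))) ⁻¹' O := by
    ext y
    simp only [Set.mem_setOf_eq, Set.mem_inter_iff, Set.mem_preimage]
    constructor
    · rintro ⟨hy, hR⟩
      exact ⟨hy, ((Set.ext_iff.1 hEq _).1 hR).2⟩
    · rintro ⟨hy, hyO⟩
      have hyA := ResGLnCone.mapsTo_coneActionRat_posCone n K A hy
      exact ⟨hy, (Set.ext_iff.1 hEq _).2
        ⟨fun w => assembly_placeFamily_isHermitian_of_cone n K hyA.1 hyA.2 w, hyO⟩⟩
  rw [h]
  exact (ResGLnCone.isOpen_posCone n K).inter (hO.preimage hcont)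

end FamPOU

/-! ### The registered stub -/

section ConeFormAnalytic

open scoped Matrix.Norms.Operator Topology
open Filter

attribute [-instance] instTopologicalSpaceMatrix
attribute [-instance] Matrix.instUniformSpace
attribute [local instance high] NormedAddCommGroup.toSeminormedAddCommGroup

set_option maxHeartbeats 400000 in
/-- **Stub FAM-POU — a partition of unity for the arithmetic stabiliser of a coset, with growth data.**
For each coset `c` of the level: reduction constants `p₀ < p₁` (componentwise), a finite set `T` of rational
translates such that the `Γ_c T`-translates of the `p₀`-reduced set cover the cone (COVER-FIN (i)), the
smooth cut-off `χ` of POU-A (`= 1` on `p₀`-reduced, `0` off `p₁`-reduced, polynomial `C²` bounds), the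
`T`-symmetrised cut-off `χ_T = ∑_t χ ∘ t⁻¹` (clamped by the smooth transition, so that it is `1` on the
`Γ_c T`-translates of the `p₀`-reduced set), normalised by POU-B into a `Γ_c`-partition of unity
`ψ = χ_T / ∑_γ χ_T ∘ γ⁻¹` on the positive cone; the finite set `Δ ⊆ Γ_c` of elements moving a `T`-translate of
the `p₁`-reduced set onto another (COVER-FIN (ii)) is the only set of translates of `ψ` alive near the
fundamental set `F' = ⋃_t t · R(p₀)`, and there the translates have `C²` bounds polynomial in the entries of
`H, H⁻¹` (quotient rule of POU-B, chain rule through the fixed linear maps `(γ t)⁻¹`).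
[cite: Borel1983Regularization, §3.5] [cite: Borel1969, §12–§15] [cite: BottTu1982Forms, §II.8] -/
theorem stub_fam_pou (n : ℕ) (K : Type) [Field K] [NumberField K] (𝔫 : Ideal (𝓞 K))
    (c : BigHeckeGLn.FiniteAdelicGL n K ⧸ ResGLnCohomology.level n K 𝔫) :
    ∃ (ψ : ResGLnCone.hermSpace n K → ℝ) (T : Finset (GL (Fin n) K)) (c₀ C₀ τ₀ : ℝ)
      (Δ : Finset ((MulAction.stabilizer (BigHeckeGLn.FiniteAdelicGL n K) c).comap (ResGLnCohomology.diagPos n K))),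
      0 < c₀ ∧ 1 < C₀ ∧ 0 < τ₀ ∧
      TwistedQuotient.IsPOU
        (((ResGLnCone.coneActionRat n K).comp (ResGLnCohomology.glTotPos n K).subtype).comp
        ((MulAction.stabilizer (BigHeckeGLn.FiniteAdelicGL n K) c).comap (ResGLnCohomology.diagPos n K)).subtype)
        (ResGLnCone.posCone n K) ψ ∧
      (∀ H ∈ ResGLnCone.posCone n K, ∃ (γ : ((MulAction.stabilizer (BigHeckeGLn.FiniteAdelicGL n K) c).comap (ResGLnCohomology.diagPos n K))) (t : GL (Fin n) K), t ∈ T ∧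
        SiegelFamily.IsReduced c₀ C₀ τ₀ n (SiegelFamily.placeFamily K
          ((ResGLnCone.coneActionRat n K (((γ : ResGLnCohomology.glTotPos n K) : GL (Fin n) K) * t)⁻¹ H :
            ResGLnCone.hermSpace n K) : Matrix (Fin n) (Fin n) (mixedSpace K)))) ∧
      (∀ γ : ((MulAction.stabilizer (BigHeckeGLn.FiniteAdelicGL n K) c).comap (ResGLnCohomology.diagPos n K)), γ ∉ Δ →
        ∀ x ∈ {H : ResGLnCone.hermSpace n K | H ∈ ResGLnCone.posCone n K ∧ ∃ t ∈ T,
          SiegelFamily.IsReduced c₀ C₀ τ₀ n (SiegelFamily.placeFamily K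
            ((ResGLnCone.coneActionRat n K t⁻¹ H : ResGLnCone.hermSpace n K) :
              Matrix (Fin n) (Fin n) (mixedSpace K)))},
          (fun y => ψ ((((ResGLnCone.coneActionRat n K).comp (ResGLnCohomology.glTotPos n K).subtype).comp
        ((MulAction.stabilizer (BigHeckeGLn.FiniteAdelicGL n K) c).comap (ResGLnCohomology.diagPos n K)).subtype) γ⁻¹ y)) =ᶠ[𝓝 x] fun _ => 0) ∧
      ∃ (C : ℝ) (k : ℕ), ∀ γ ∈ Δ,
        ∀ x ∈ {H : ResGLnCone.hermSpace n K | H ∈ ResGLnCone.posCone n K ∧ ∃ t ∈ T,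
          SiegelFamily.IsReduced c₀ C₀ τ₀ n (SiegelFamily.placeFamily K
            ((ResGLnCone.coneActionRat n K t⁻¹ H : ResGLnCone.hermSpace n K) :
              Matrix (Fin n) (Fin n) (mixedSpace K)))},
          |ψ ((((ResGLnCone.coneActionRat n K).comp (ResGLnCohomology.glTotPos n K).subtype).comp
        ((MulAction.stabilizer (BigHeckeGLn.FiniteAdelicGL n K) c).comap (ResGLnCohomology.diagPos n K)).subtype) γ⁻¹ x)| ≤ C * (1 + ∑ i, ∑ j,
            (‖(x : Matrix (Fin n) (Fin n) (mixedSpace K)) i j‖ +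
              ‖(x : Matrix (Fin n) (Fin n) (mixedSpace K))⁻¹ i j‖)) ^ k ∧
          ‖fderiv ℝ (fun y => ψ ((((ResGLnCone.coneActionRat n K).comp (ResGLnCohomology.glTotPos n K).subtype).comp
        ((MulAction.stabilizer (BigHeckeGLn.FiniteAdelicGL n K) c).comap (ResGLnCohomology.diagPos n K)).subtype) γ⁻¹ y)) x‖ ≤ C * (1 + ∑ i, ∑ j,
            (‖(x : Matrix (Fin n) (Fin n) (mixedSpace K)) i j‖ +
              ‖(x : Matrix (Fin n) (Fin n) (mixedSpace K))⁻¹ i j‖)) ^ k ∧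
          ‖iteratedFDeriv ℝ 2 (fun y => ψ ((((ResGLnCone.coneActionRat n K).comp (ResGLnCohomology.glTotPos n K).subtype).comp
        ((MulAction.stabilizer (BigHeckeGLn.FiniteAdelicGL n K) c).comap (ResGLnCohomology.diagPos n K)).subtype) γ⁻¹ y)) x‖ ≤ C * (1 + ∑ i, ∑ j,
            (‖(x : Matrix (Fin n) (Fin n) (mixedSpace K)) i j‖ +
              ‖(x : Matrix (Fin n) (Fin n) (mixedSpace K))⁻¹ i j‖)) ^ k := by
  classical
  -- reduction theory for `Γ_c` in the cone (COVER-FIN)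
  obtain ⟨⟨c₀, C₀, τ₀, T, hc₀, hC₀, hτ₀, hcov⟩, hfin⟩ := stub_reducedCone_cover_finite n K 𝔫 c
  -- the smooth Siegel cut-off between `p₀ = (c₀, C₀, τ₀)` and `p₁ = p₀ + 1` (POU-A)
  obtain ⟨χ, hχs, hχ01, hχ1, hχ0, Cχ, kχ, hχb⟩ := stub_siegelCutoff n K hc₀ hC₀ hτ₀
    (lt_add_one c₀) (lt_add_one C₀) (lt_add_one τ₀)
  /- notation: the group, the action, the cone -/
  set Γ : Subgroup (ResGLnCohomology.glTotPos n K) :=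
    (MulAction.stabilizer (BigHeckeGLn.FiniteAdelicGL n K) c).comap (ResGLnCohomology.diagPos n K)
    with hΓ
  set a := ((ResGLnCone.coneActionRat n K).comp (ResGLnCohomology.glTotPos n K).subtype).comp
    Γ.subtype with ha
  set X : Set (ResGLnCone.hermSpace n K) := ResGLnCone.posCone n K with hX
  have hXo : IsOpen X := ResGLnCone.isOpen_posCone n K
  have hmem : ∀ (A : GL (Fin n) K) {x : ResGLnCone.hermSpace n K}, x ∈ X →
      ResGLnCone.coneActionRat n K A x ∈ X :=
    fun A _ hx => ResGLnCone.mapsTo_coneActionRat_posCone n K A hx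
  have ha_apply : ∀ (γ : Γ) (y : ResGLnCone.hermSpace n K), a γ y =
      ResGLnCone.coneActionRat n K ((γ : ResGLnCohomology.glTotPos n K) : GL (Fin n) K) y :=
    fun γ y => rfl
  have ha_inv : ∀ (γ : Γ) (y : ResGLnCone.hermSpace n K), a γ⁻¹ y =
      ResGLnCone.coneActionRat n K ((γ : ResGLnCohomology.glTotPos n K) : GL (Fin n) K)⁻¹ y :=
    fun γ y => rfl
  have hmaps : ∀ γ : Γ, Set.MapsTo (a γ) X X := fun γ x hx => by
    rw [ha_apply]
    exact hmem _ hx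
  have hmemΓ : ∀ {g : ResGLnCohomology.glTotPos n K}, ResGLnCohomology.diagPos n K g • c = c →
      g ∈ Γ := fun h => Subgroup.mem_comap.2 (MulAction.mem_stabilizer_iff.2 h)
  have hcomp := @ResGLnCone.coneActionRat_coneActionRat n K _ _
  /- the reduced sets for `p₀` and `p₁` -/
  let R₀ : ResGLnCone.hermSpace n K → Prop := fun H => SiegelFamily.IsReduced c₀ C₀ τ₀ n
    (SiegelFamily.placeFamily K (H : Matrix (Fin n) (Fin n) (mixedSpace K)))
  let R₁ : ResGLnCone.hermSpace n K → Prop := fun H =>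
    SiegelFamily.IsReduced (c₀ + 1) (C₀ + 1) (τ₀ + 1) n
      (SiegelFamily.placeFamily K (H : Matrix (Fin n) (Fin n) (mixedSpace K)))
  have hR01 : ∀ H, R₀ H → R₁ H := fun H h =>
    SiegelFamily.IsReduced.mono (lt_add_one c₀).le (lt_add_one C₀).le (lt_add_one τ₀).le h
  /- the symmetrised, clamped cut-off `χ₁ = θ (∑_{t ∈ T} χ ∘ t⁻¹)` -/
  let χ₁ : ResGLnCone.hermSpace n K → ℝ := fun x =>
    Real.smoothTransition (∑ t ∈ T, χ (ResGLnCone.coneActionRat n K t⁻¹ x))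
  have hχ₁ : χ₁ = fun x =>
      Real.smoothTransition (∑ t ∈ T, χ (ResGLnCone.coneActionRat n K t⁻¹ x)) := rfl
  have hχ₁01 : ∀ x, 0 ≤ χ₁ x ∧ χ₁ x ≤ 1 := fun x =>
    ⟨Real.smoothTransition.nonneg _, Real.smoothTransition.le_one _⟩
  have hχ₁s : ContDiffOn ℝ ((⊤ : ℕ∞) : WithTop ℕ∞) χ₁ X :=
    Real.smoothTransition.contDiff.comp_contDiffOn (ContDiffOn.sum fun t _ =>
      hχs.comp (ResGLnCone.coneActionRat n K t⁻¹).contDiff.contDiffOn fun y hy => hmem _ hy)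
  -- the translates `χ₁ ∘ a δ⁻¹`, written through single translations `(t⁻¹ δ⁻¹) ·`
  have hχ₁a : ∀ δ : Γ, (fun y => χ₁ (a δ⁻¹ y)) = fun y => Real.smoothTransition
      (∑ t ∈ T, χ (ResGLnCone.coneActionRat n K
        (t⁻¹ * ((δ : ResGLnCohomology.glTotPos n K) : GL (Fin n) K)⁻¹) y)) := by
    intro δ
    funext y
    simp only [hχ₁, ha_inv, hcomp]
  /- the finite set `Δ` (COVER-FIN (ii) for `p₁`, over `t, t' ∈ T`) -/
  have hSfin := fun t t' : GL (Fin n) K => hfin (c₀ + 1) (C₀ + 1) (τ₀ + 1) t t'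
  set Δ : Finset Γ := T.biUnion fun t => T.biUnion fun t' =>
    ((hSfin t t').preimage (Subtype.val_injective (p := fun g => g ∈ Γ)).injOn).toFinset with hΔ
  have hmemΔ : ∀ {γ : Γ} {t t' : GL (Fin n) K}, t ∈ T → t' ∈ T →
      ∀ {H : ResGLnCone.hermSpace n K}, H ∈ X →
      R₁ (ResGLnCone.coneActionRat n K
        (((γ : ResGLnCohomology.glTotPos n K) : GL (Fin n) K) * t)⁻¹ H) →
      R₁ (ResGLnCone.coneActionRat n K t'⁻¹ H) → γ ∈ Δ := by
    intro γ t t' ht ht' H hH h1 h2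
    rw [hΔ, Finset.mem_biUnion]
    refine ⟨t, ht, Finset.mem_biUnion.2 ⟨t', ht', ?_⟩⟩
    rw [Set.Finite.mem_toFinset, Set.mem_preimage]
    exact ⟨γ.2, H, hH, h1, h2⟩
  /- near a point of `γ₀ t₀ · R(p₁)`, only translates `χ₁ ∘ a γ⁻¹` with `γ₀⁻¹ γ ∈ Δ` are alive -/
  have hloc : ∀ (γ₀ : Γ) {t₀ : GL (Fin n) K}, t₀ ∈ T → ∀ {x : ResGLnCone.hermSpace n K}, x ∈ X →
      R₁ (ResGLnCone.coneActionRat n K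
        (((γ₀ : ResGLnCohomology.glTotPos n K) : GL (Fin n) K) * t₀)⁻¹ x) →
      ∃ U ∈ 𝓝 x, ∀ y ∈ U, ∀ γ : Γ, χ₁ (a γ⁻¹ y) ≠ 0 → γ₀⁻¹ * γ ∈ Δ := by
    intro γ₀ t₀ ht₀ x hx hR
    refine ⟨_, (FamPOU.isOpen_setOf_isReduced_coneActionRat
      (((γ₀ : ResGLnCohomology.glTotPos n K) : GL (Fin n) K) * t₀)⁻¹ (c₀ + 1) (C₀ + 1)
        (τ₀ + 1)).mem_nhds ⟨hx, hR⟩, ?_⟩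
    rintro y ⟨hy, hyR⟩ γ hne
    -- some `t ∈ T` with `χ (t⁻¹ γ⁻¹ · y) ≠ 0`, hence `t⁻¹ γ⁻¹ · y ∈ R(p₁)`
    have hpos : 0 < ∑ t ∈ T, χ (ResGLnCone.coneActionRat n K t⁻¹ (a γ⁻¹ y)) := by
      by_contra h
      exact hne (Real.smoothTransition.zero_of_nonpos (not_lt.1 h))
    obtain ⟨t, ht, hχt⟩ := Finset.exists_ne_zero_of_sum_ne_zero hpos.ne'
    have hR₁t : R₁ (ResGLnCone.coneActionRat n K t⁻¹ (a γ⁻¹ y)) :=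
      hχ0 _ (hmem _ (hmaps _ hy)) hχt
    refine hmemΔ ht ht₀ (hmaps γ₀⁻¹ hy) ?_ ?_
    · have e : (((γ₀⁻¹ * γ : Γ) : ResGLnCohomology.glTotPos n K) : GL (Fin n) K) * t =
          (t⁻¹ * ((γ : ResGLnCohomology.glTotPos n K) : GL (Fin n) K)⁻¹ *
            ((γ₀ : ResGLnCohomology.glTotPos n K) : GL (Fin n) K))⁻¹ := by
        push_cast
        group
      rw [e, inv_inv, ha_inv, hcomp, mul_assoc, mul_inv_cancel, mul_one, ← hcomp, ← ha_inv]
      exact hR₁t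
    · rw [ha_inv, hcomp, ← mul_inv_rev]
      exact hyR
  /- the hypotheses of POU-B -/
  have hfinB : ∀ x ∈ X, ∃ U ∈ 𝓝 x, {γ : Γ | ∃ y ∈ U, χ₁ (a γ⁻¹ y) ≠ 0}.Finite := by
    intro x hx
    obtain ⟨g₀, hg₀, t₀, ht₀, hR⟩ := hcov x hx
    obtain ⟨U, hU, hUΔ⟩ := hloc ⟨g₀, hmemΓ hg₀⟩ ht₀ hx (hR01 _ hR)
    refine ⟨U, hU, ((Δ : Set Γ).toFinite.image fun δ => (⟨g₀, hmemΓ hg₀⟩ : Γ) * δ).subset ?_⟩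
    rintro γ ⟨y, hy, hne⟩
    exact ⟨_, hUΔ y hy γ hne, mul_inv_cancel_left _ _⟩
  have hcovB : ∀ x ∈ X, ∃ γ : Γ, χ₁ (a γ⁻¹ x) = 1 := by
    intro x hx
    obtain ⟨g₀, hg₀, t₀, ht₀, hR⟩ := hcov x hx
    refine ⟨⟨g₀, hmemΓ hg₀⟩, Real.smoothTransition.one_of_one_le ?_⟩
    have hpt : ∀ t : GL (Fin n) K, ResGLnCone.coneActionRat n K t⁻¹
        (a (⟨g₀, hmemΓ hg₀⟩ : Γ)⁻¹ x) ∈ X := fun t => hmem _ (hmaps _ hx)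
    have h1 : χ (ResGLnCone.coneActionRat n K t₀⁻¹ (a (⟨g₀, hmemΓ hg₀⟩ : Γ)⁻¹ x)) = 1 := by
      refine hχ1 _ (hpt t₀) ?_
      rw [ha_inv, hcomp, ← mul_inv_rev]
      exact hR
    calc (1 : ℝ) = χ (ResGLnCone.coneActionRat n K t₀⁻¹ (a (⟨g₀, hmemΓ hg₀⟩ : Γ)⁻¹ x)) := h1.symm
      _ ≤ ∑ t ∈ T, χ (ResGLnCone.coneActionRat n K t⁻¹ (a (⟨g₀, hmemΓ hg₀⟩ : Γ)⁻¹ x)) :=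
        Finset.single_le_sum (f := fun t => χ (ResGLnCone.coneActionRat n K t⁻¹
          (a (⟨g₀, hmemΓ hg₀⟩ : Γ)⁻¹ x))) (fun t _ => (hχ01 _ (hpt t)).1) ht₀
  /- POU-B -/
  obtain ⟨hPOU, -, -, hψ01, hbd⟩ :=
    stub_isPOU_of_cover a hXo hmaps χ₁ hχ₁s (fun x _ => (hχ₁01 x).1) hfinB hcovB
  /- the fundamental set `F'` and the vanishing of the far translates near it -/
  let F' : Set (ResGLnCone.hermSpace n K) := {H : ResGLnCone.hermSpace n K | H ∈ X ∧ ∃ t ∈ T,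
    SiegelFamily.IsReduced c₀ C₀ τ₀ n (SiegelFamily.placeFamily K
      ((ResGLnCone.coneActionRat n K t⁻¹ H : ResGLnCone.hermSpace n K) :
        Matrix (Fin n) (Fin n) (mixedSpace K)))}
  have hF'X : F' ⊆ X := fun x hx => hx.1
  have hvan : ∀ x ∈ F', ∀ γ : Γ, γ ∉ Δ → (fun y => χ₁ (a γ⁻¹ y)) =ᶠ[𝓝 x] fun _ => 0 := by
    rintro x ⟨hx, t₀, ht₀, hR⟩ γ hγ
    have hR' : R₁ (ResGLnCone.coneActionRat n K
        ((((1 : Γ) : ResGLnCohomology.glTotPos n K) : GL (Fin n) K) * t₀)⁻¹ x) := by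
      rw [OneMemClass.coe_one, OneMemClass.coe_one, one_mul]
      exact hR01 _ hR
    obtain ⟨U, hU, hUΔ⟩ := hloc 1 ht₀ hx hR'
    filter_upwards [hU] with y hy
    by_contra h
    exact hγ (by simpa only [inv_one, one_mul] using hUΔ y hy γ h)
  /- the entry gauge and the growth of the translates of `χ₁` -/
  let E : ResGLnCone.hermSpace n K → ℝ := fun x => 1 + ∑ i, ∑ j,
    (‖(x : Matrix (Fin n) (Fin n) (mixedSpace K)) i j‖ +
      ‖(x : Matrix (Fin n) (Fin n) (mixedSpace K))⁻¹ i j‖)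
  have hE1 : ∀ x : ResGLnCone.hermSpace n K, 1 ≤ E x := fun x =>
    le_add_of_nonneg_right (Finset.sum_nonneg fun i _ => Finset.sum_nonneg fun j _ =>
      add_nonneg (norm_nonneg _) (norm_nonneg _))
  have hE1X : ∀ x ∈ X, 1 ≤ E x := fun x _ => hE1 x
  have hEA : ∀ A : GL (Fin n) K, ∃ (C : ℝ) (k : ℕ), ∀ x ∈ X,
      E (ResGLnCone.coneActionRat n K A x) ≤ C * E x ^ k := fun A => by
    obtain ⟨C, -, h⟩ := ResGLnCone.entryGauge_coneActionRat_le A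
    exact ⟨C, 1, fun x _ => by simpa only [pow_one] using h x⟩
  -- `χ` is tame for the entry gauge (POU-A), hence so are the translates `χ₁ ∘ a δ⁻¹` on `X`
  have hχt := Literature.Analysis.Calculus.tame_of_apply_bounds hXo hE1X hχs (C₀ := 1)
    (fun H hH => abs_le.2 ⟨by linarith [(hχ01 H hH).1], (hχ01 H hH).2⟩) hχb
  have hD12 : ∀ δ : Γ, ∃ (C : ℝ) (k : ℕ), ∀ x ∈ X,
      ‖fderiv ℝ (fun y => χ₁ (a δ⁻¹ y)) x‖ ≤ C * E x ^ k ∧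
        ‖iteratedFDeriv ℝ 2 (fun y => χ₁ (a δ⁻¹ y)) x‖ ≤ C * E x ^ k := by
    intro δ
    rw [hχ₁a δ]
    obtain ⟨-, C, k, hb⟩ := ResGLnCone.tame_smoothTransition_sum_translate E hE1X hEA hχt T
      ((δ : ResGLnCohomology.glTotPos n K) : GL (Fin n) K)⁻¹
    exact ⟨C, k, fun x hx => Literature.Analysis.Calculus.norm_fderiv_le_of_tame hXo hx (hb x hx)⟩
  have hχ₁abs : ∀ x ∈ X, ∀ δ : Γ, |χ₁ (a δ⁻¹ x)| ≤ 1 := fun x _ δ =>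
    abs_le.2 ⟨by linarith [(hχ₁01 (a δ⁻¹ x)).1], (hχ₁01 _).2⟩
  /- assembling -/
  refine ⟨fun x => χ₁ x / ∑ᶠ γ : Γ, χ₁ (a γ⁻¹ x), T, c₀, C₀, τ₀, Δ, hc₀, hC₀, hτ₀, hPOU, ?_, ?_, ?_⟩
  · -- the cover (COVER-FIN (i))
    intro H hH
    obtain ⟨g₀, hg₀, t₀, ht₀, hR⟩ := hcov H hH
    exact ⟨⟨g₀, hmemΓ hg₀⟩, t₀, ht₀, hR⟩
  · -- far translates vanish near `F'`
    intro γ hγ x hx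
    filter_upwards [hvan x hx γ hγ] with y hy
    simp only [hy, zero_div]
  · -- the growth of the translates `ψ ∘ a γ⁻¹`, `γ ∈ Δ`, on `F'`
    exact Literature.Analysis.Calculus.pou_translate_bounds a hF'X χ₁ hE1X Δ hψ01 hbd hvan hχ₁abs
      fun δ _ => hD12 δ

end ConeFormAnalytic

end Summit.Langlands.Langlands.Theorems.HeckeEigenvalueField.Res

end
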